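import Literature.Geometry.Riemannian.HeatKernelFnUpperBound
import Literature.Geometry.Riemannian.RicciFlowIntegralDeriv
import Literature.Geometry.Riemannian.HeatPropagation
import HarnessLib

/-!
# The forward-variable mass of the heat kernel of a Ricci flow:
# `∫_M K(x,t;y,s) dg_t(x) ≤ e^{−R_min (t − s)}` (Bamler 2020a, §7.2, (7.3))

R. Bamler, *Entropy and heat kernel bounds on a Ricci flow background*, arXiv:2008.07093 (2020a),
§7.2, proof of Thm. 7.1, display (7.3): for the heat kernel `K` of a Ricci flow on a closed
manifold with `R ≥ R_min` on `M × [s, t]`, the function `u(x, t) = K(x,t;y,s)` solves the heat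
equation in the forward variables, so "since `d/dt ∫_M u dg_t = −∫_M R u dg_t ≤ −R_min ∫_M u dg_t`,
we have `∫_M u dg_t ≤ e^{−R_min (t − s)}`" (the mass of the fundamental solution tends to `1` at
the pole). This file proves the display for a Ricci flow `hflow = (h, cov)` on `[a, T]` of a `C^∞`
family of Riemannian metrics on a closed connected manifold `M` (modelled on `ℝᵐ`), with the tree's
heat kernel function `K = hflow.heatKernelFn hh hR` (`RicciFlowHeatKernelFn.lean`):

* `IsRicciFlow.integral_heat_le_exp_neg_mul_integral` — for a heat solution `w ≥ 0` on `[0, T']`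
  of a flow with `R ≥ R_min`, `∫ w(t) dV_t ≤ e^{−R_min t} ∫ w(0) dV_0` (Grönwall, from
  `d/dt ∫ w dV = −∫ R w dV`, `IsRicciFlow.hasDerivWithinAt_integral_heat`);
* `IsRicciFlow.integral_heatValue_le_exp_neg_mul` — the same for the heat propagation
  `P_{s→t}φ` of smooth `φ ≥ 0`: `∫ (P_{s→t}φ) dV_t ≤ e^{−R_min (t−s)} ∫ φ dV_s`;
* `IsRicciFlow.integral_heatValue_eq_integral_integral_heatKernelFn_mul` — Fubini:
  `∫ (P_{s→t}φ)(x) dV_t(x) = ∫ (∫ K(x,t;y,s) dV_t(x)) φ(y) dV_s(y)`;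
* `IsRicciFlow.continuous_integral_heatKernelFn_basePoint` — `y ↦ ∫ K(x,t;y,s) dV_t(x)` is
  continuous;
* `integral_heatKernelFn_basePoint_le_exp` — **(7.3)**: `∫ K(x,t;y,s) dV_t(x) ≤ e^{−R_min (t−s)}`
  for `a < s < t ≤ T` and every `y`, by the fundamental lemma
  (`le_of_forall_integral_mul_contMDiff_le`) from the two previous items.

The route through the heat propagation of smooth data avoids the pole of `K` at `t = s`.
Everything is proved; no definitions, no named facts. What is NOT here: the Gaussian upper bound
of Thm. 7.1 itself, lower bounds for the mass, non-compact flows.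

## References

* R. H. Bamler, *Entropy and heat kernel bounds on a Ricci flow background*, arXiv:2008.07093
  (2020), §7.2, proof of Thm. 7.1, (7.3). [Bamler2020Entropy]
* P. Topping, *Lectures on the Ricci flow*, LMS Lecture Note Series 325, CUP 2006, §6.3, (6.3.2)
  (`d/dt ∫ w dV = −∫ □* w dV`). [Topping2006]
-/

noncomputable section

open Bundle Set Function Filter Manifold MeasureTheory Measure TopologicalSpace
open scoped Manifold ContDiff Topology ENNReal NNReal

namespace Literature.Geometry.Riemannian

open Lorentzian Lorentzian.PseudoRiemannianMetric

section ForwardMass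

variable {m : ℕ} {H : Type*} [TopologicalSpace H]
  {I : ModelWithCorners ℝ (EuclideanSpace ℝ (Fin m)) H} [I.Boundaryless]
  {M : Type*} [TopologicalSpace M] [ChartedSpace H M] [IsManifold I ∞ M]
  [T2Space M] [CompactSpace M] [SecondCountableTopology M] [MeasurableSpace M] [BorelSpace M]
  [PreconnectedSpace M]
  {h : ℝ → PseudoRiemannianMetric I ∞ (EuclideanSpace ℝ (Fin m)) (TangentSpace I : M → Type _)}
  {cov : ℝ → CovariantDerivative I (EuclideanSpace ℝ (Fin m)) (TangentSpace I : M → Type _)}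
  {a T : ℝ}

omit [SecondCountableTopology M] [PreconnectedSpace M] in
/-- **Mass bound for non-negative heat solutions along a Ricci flow with scalar curvature bounded
below** (Bamler 2020a, §7.2, the argument for (7.3): "`d/dt ∫_M u dg_t = −∫_M R u dg_t ≤
−R_min ∫_M u dg_t`"; Topping 2006, (6.3.2)): for a Ricci flow of Riemannian metrics `(h, cov)` on
`[0, T']`, `0 < T'`, on a closed manifold modelled on `ℝᵐ`, a smooth solution `w ≥ 0` of
`∂ₜw = Δ_{h(t)} w` on `M × [0, T']` and a bound `R ≥ R_min` on `M × [0, T']`,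
`∫ w(t) dV_{h(t)} ≤ e^{−R_min t} ∫ w(0) dV_{h(0)}` for all `t ∈ [0, T']`
(`e^{R_min t} ∫ w(t) dV_{h(t)}` is non-increasing, by `IsRicciFlow.hasDerivWithinAt_integral_heat`).
[cite: Bamler2020Entropy, §7.2, (7.3)] -/
theorem IsRicciFlow.integral_heat_le_exp_neg_mul_integral {T' : ℝ} (hT' : 0 < T')
    (hflow : IsRicciFlow h cov (Icc 0 T')) (hR : ∀ t ∈ Icc 0 T', (h t).IsRiemannian)
    {w : ℝ → M → ℝ} (hw : IsHeatSolutionOn h w 0 T') (hw0 : ∀ t ∈ Icc 0 T', ∀ x, 0 ≤ w t x)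
    {Rmin : ℝ} (hRmin : ∀ t ∈ Icc 0 T', ∀ x, Rmin ≤ (h t).scalarCurvatureWith (cov t) x)
    {t : ℝ} (ht : t ∈ Icc 0 T') :
    ∫ x, w t x ∂(h t).riemVolume ≤ Real.exp (-Rmin * t) * ∫ x, w 0 x ∂(h 0).riemVolume := by
  -- `F(r) = e^{R_min r} ∫ w(r) dV_{h(r)}` and its derivative within `[0, T']`
  set F : ℝ → ℝ := fun r ↦ Real.exp (Rmin * r) * ∫ x, w r x ∂(h r).riemVolume with hF
  set F' : ℝ → ℝ := fun r ↦ Real.exp (Rmin * r) * (Rmin * 1) * ∫ x, w r x ∂(h r).riemVolume +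
    Real.exp (Rmin * r) * -∫ x, (h r).scalarCurvatureWith (cov r) x * w r x ∂(h r).riemVolume
    with hF'
  have hderiv : ∀ r ∈ Icc 0 T', HasDerivWithinAt F (F' r) (Icc 0 T') r := by
    intro r hr
    have hexp : HasDerivAt (fun r' ↦ Real.exp (Rmin * r')) (Real.exp (Rmin * r) * (Rmin * 1)) r :=
      ((hasDerivAt_id' r).const_mul Rmin).exp
    exact hexp.hasDerivWithinAt.mul (hflow.hasDerivWithinAt_integral_heat hT' hR hw hr)
  -- `F' ≤ 0` on `[0, T']`: `-∫ R w dV ≤ -R_min ∫ w dV`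
  have hF'le : ∀ r ∈ Icc 0 T', F' r ≤ 0 := by
    intro r hr
    have hwr : ContMDiff I 𝓘(ℝ, ℝ) ∞ (w r) := contMDiff_slice_of_contMDiffOn hw.1 hr
    have hRr : Continuous fun x ↦ (h r).scalarCurvatureWith (cov r) x :=
      (contMDiff_slice_of_contMDiffOn (u := fun r' x ↦ (h r').scalarCurvatureWith (cov r') x)
        hflow.contMDiffOn_scalarCurvatureWith hr).continuous
    have hle : -∫ x, (h r).scalarCurvatureWith (cov r) x * w r x ∂(h r).riemVolume ≤
        -Rmin * ∫ x, w r x ∂(h r).riemVolume := by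
      rw [← integral_neg, ← integral_const_mul]
      refine integral_mono ((h r).integrable_of_continuous (hRr.mul hwr.continuous)).neg
        (((h r).integrable_of_continuous hwr.continuous).const_mul (-Rmin)) fun x ↦ ?_
      show -((h r).scalarCurvatureWith (cov r) x * w r x) ≤ -Rmin * w r x
      rw [neg_mul]
      exact neg_le_neg (mul_le_mul_of_nonneg_right (hRmin r hr x) (hw0 r hr x))
    have hpos : 0 < Real.exp (Rmin * r) := Real.exp_pos _
    have hcalc : F' r = Real.exp (Rmin * r) *
        (-∫ x, (h r).scalarCurvatureWith (cov r) x * w r x ∂(h r).riemVolume -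
          -Rmin * ∫ x, w r x ∂(h r).riemVolume) := by
      rw [hF']
      ring
    rw [hcalc]
    exact mul_nonpos_of_nonneg_of_nonpos hpos.le (sub_nonpos.2 hle)
  -- hence `F` is non-increasing on `[0, T']`
  have hcont : ContinuousOn F (Icc 0 T') := fun r hr ↦ (hderiv r hr).continuousWithinAt
  have hanti : AntitoneOn F (Icc 0 T') :=
    antitoneOn_of_hasDerivWithinAt_nonpos (convex_Icc 0 T') hcont
      (fun r hr ↦ (hderiv r (interior_subset hr)).mono interior_subset)
      fun r hr ↦ hF'le r (interior_subset hr)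
  have h0 : (0 : ℝ) ∈ Icc 0 T' := ⟨le_rfl, hT'.le⟩
  have hFt : F t ≤ F 0 := hanti h0 ht ht.1
  have hF0 : F 0 = ∫ x, w 0 x ∂(h 0).riemVolume := by
    simp [hF]
  have hone : Real.exp (-Rmin * t) * Real.exp (Rmin * t) = 1 := by
    rw [← Real.exp_add]
    simp [neg_mul]
  calc ∫ x, w t x ∂(h t).riemVolume
      = Real.exp (-Rmin * t) * F t := by
        rw [hF, ← mul_assoc, hone, one_mul]
    _ ≤ Real.exp (-Rmin * t) * F 0 := mul_le_mul_of_nonneg_left hFt (Real.exp_pos _).le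
    _ = Real.exp (-Rmin * t) * ∫ x, w 0 x ∂(h 0).riemVolume := by rw [hF0]

omit [PreconnectedSpace M] in
/-- **Mass bound for the heat propagation of a Ricci flow with `R ≥ R_min`** (Bamler 2020a, §7.2,
the argument for (7.3)): for a Ricci flow `(h, cov)` on `[a, T]` of a `C^∞` family of Riemannian
metrics on a closed manifold, `a ≤ s < t ≤ T`, `R ≥ R_min` on `M × [s, t]` and smooth `φ ≥ 0`,
`∫ (P_{s→t}φ)(x) dV_{h(t)}(x) ≤ e^{−R_min (t − s)} ∫ φ dV_{h(s)}`
(`integral_heat_le_exp_neg_mul_integral` for the heat solution `(r, x) ↦ (P_{s→r}φ)(x)`,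
`isHeatSolutionOn_heatValue`, after translating the flow to start at time `0`).
[cite: Bamler2020Entropy, §7.2, (7.3)] -/
theorem IsRicciFlow.integral_heatValue_le_exp_neg_mul (hflow : IsRicciFlow h cov (Icc a T))
    (hh : IsContMDiffFamilyOn ∞ h univ) (hR : ∀ r, (h r).IsRiemannian) {s t : ℝ} (has : a ≤ s)
    (hst : s < t) (htT : t ≤ T) {Rmin : ℝ}
    (hRmin : ∀ r ∈ Icc s t, ∀ z : M, Rmin ≤ (h r).scalarCurvatureWith (cov r) z) {φ : M → ℝ}
    (hφ : ContMDiff I 𝓘(ℝ, ℝ) ∞ φ) (hφ0 : ∀ y, 0 ≤ φ y) :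
    ∫ x, heatValue h s t x φ ∂(h t).riemVolume ≤
      Real.exp (-Rmin * (t - s)) * ∫ y, φ y ∂(h s).riemVolume := by
  set τ : ℝ := t - s with hτ
  have hτ0 : 0 < τ := sub_pos.2 hst
  -- the translated flow on `[0, τ]` and the translated heat propagation
  have hflow₁ : IsRicciFlow (fun r ↦ h (r + s)) (fun r ↦ cov (r + s)) (Icc 0 τ) := by
    refine (hflow.comp_add_const s).mono fun r hr ↦ ?_
    exact ⟨by linarith [hr.1], by rw [hτ] at hr; linarith [hr.2]⟩
  set u : ℝ → M → ℝ := fun r y ↦ heatValue h s r y φ with hu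
  have hus : IsHeatSolutionOn h u s t := isHeatSolutionOn_heatValue hh hR hst hφ
  have hw₁ : IsHeatSolutionOn (fun r ↦ h (r + s)) (fun r ↦ u (r + s)) 0 τ := by
    simpa only [sub_self, hτ] using hus.comp_add_const s
  have hu0 : ∀ r y, 0 ≤ u r y := fun r y ↦ by
    have h1 := heatValue_mono hh hR (s := s) (t := r) y contMDiff_const hφ hφ0
    rwa [heatValue_const hR] at h1
  have hmem : ∀ r ∈ Icc 0 τ, r + s ∈ Icc s t := fun r hr ↦
    ⟨by linarith [hr.1], by rw [hτ] at hr; linarith [hr.2]⟩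
  have key : ∫ x, u (τ + s) x ∂(h (τ + s)).riemVolume ≤
      Real.exp (-Rmin * τ) * ∫ x, u (0 + s) x ∂(h (0 + s)).riemVolume :=
    hflow₁.integral_heat_le_exp_neg_mul_integral hτ0 (fun r _ ↦ hR _) hw₁
      (fun r _ y ↦ hu0 _ y) (fun r hr y ↦ hRmin _ (hmem r hr) y) ⟨hτ0.le, le_rfl⟩
  have e1 : τ + s = t := by rw [hτ]; ring
  have hu_s : u s = φ := funext fun y ↦ heatValue_of_le le_rfl y φ
  rw [e1, zero_add, hu_s] at key
  exact key

/-- **Fubini for the heat propagation against the heat kernel**: for `t ∈ (a, T]`, `s ∈ (a, t)`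
and smooth `φ`, `∫ (P_{s→t}φ)(x) dV_{h(t)}(x) = ∫ (∫ K(x,t;y,s) dV_{h(t)}(x)) φ(y) dV_{h(s)}(y)`
(`(P_{s→t}φ)(x) = ∫ K(x,t;y,s) φ(y) dV_{h(s)}(y)`, `integral_heatKernelMeasure_eq_heatValue` and
`integral_heatKernelMeasure_eq_integral_mul_heatKernelFn`; `K(·,t;·,s)` is jointly continuous on the
compact `M × M`, so the order of integration may be exchanged).
[cite: Bamler2020Entropy, §7.2, (7.3)] -/
theorem IsRicciFlow.integral_heatValue_eq_integral_integral_heatKernelFn_mul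
    (hflow : IsRicciFlow h cov (Icc a T)) (hh : IsContMDiffFamilyOn ∞ h univ)
    (hR : ∀ r, (h r).IsRiemannian) {t : ℝ} (ht : t ∈ Ioc a T) {s : ℝ} (hs : s ∈ Ioo a t)
    {φ : M → ℝ} (hφ : ContMDiff I 𝓘(ℝ, ℝ) ∞ φ) :
    ∫ x, heatValue h s t x φ ∂(h t).riemVolume =
      ∫ y, (∫ x, hflow.heatKernelFn hh hR t x (y, s) ∂(h t).riemVolume) * φ y
        ∂(h s).riemVolume := by
  haveI : ∀ r, IsFiniteMeasure (h r).riemVolume := fun r ↦ ⟨(h r).riemVolume_univ_lt_top⟩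
  -- `(P_{s→t}φ)(x) = ∫ K(x,t;y,s) φ(y) dV_s(y)`
  have h1 : ∀ x, heatValue h s t x φ =
      ∫ y, hflow.heatKernelFn hh hR t x (y, s) * φ y ∂(h s).riemVolume := by
    intro x
    rw [← integral_heatKernelMeasure_eq_heatValue hh hR hs.2 x hφ,
      hflow.integral_heatKernelMeasure_eq_integral_mul_heatKernelFn hh hR ht x hs φ]
    exact integral_congr_ae (Eventually.of_forall fun y ↦ mul_comm _ _)
  -- joint continuity, hence integrability on the product
  have hK2 : Continuous fun p : M × M ↦ hflow.heatKernelFn hh hR t p.1 (p.2, s) :=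
    (hflow.continuousOn_heatKernelFn hh hR ht).comp_continuous
      (continuous_fst.prodMk (continuous_snd.prodMk continuous_const))
      fun p ↦ ⟨mem_univ _, mem_univ _, hs⟩
  have hcont : Continuous
      (uncurry fun x y ↦ hflow.heatKernelFn hh hR t x (y, s) * φ y) :=
    hK2.mul (hφ.continuous.comp continuous_snd)
  have hint : Integrable (uncurry fun x y ↦ hflow.heatKernelFn hh hR t x (y, s) * φ y)
      (((h t).riemVolume).prod ((h s).riemVolume)) :=
    hcont.integrable_of_hasCompactSupport (HasCompactSupport.of_compactSpace _)
  have h2 : ∫ x, heatValue h s t x φ ∂(h t).riemVolume =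
      ∫ x, ∫ y, hflow.heatKernelFn hh hR t x (y, s) * φ y ∂(h s).riemVolume ∂(h t).riemVolume :=
    integral_congr_ae (Eventually.of_forall h1)
  rw [h2, integral_integral_swap hint]
  refine integral_congr_ae (Eventually.of_forall fun y ↦ ?_)
  exact integral_mul_const (φ y) _

/-- **The forward-variable mass `y ↦ ∫ K(x,t;y,s) dV_{h(t)}(x)` is continuous** (`t ∈ (a, T]`,
`s ∈ (a, t)`): `K(·,t;·,s)` is jointly continuous, hence bounded, on the compact `M × M`
(dominated convergence). [cite: Bamler2020Entropy, §2.3] -/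
theorem IsRicciFlow.continuous_integral_heatKernelFn_basePoint (hflow : IsRicciFlow h cov (Icc a T))
    (hh : IsContMDiffFamilyOn ∞ h univ) (hR : ∀ r, (h r).IsRiemannian) {t : ℝ} (ht : t ∈ Ioc a T)
    {s : ℝ} (hs : s ∈ Ioo a t) :
    Continuous fun y ↦ ∫ x, hflow.heatKernelFn hh hR t x (y, s) ∂(h t).riemVolume := by
  haveI : IsFiniteMeasure (h t).riemVolume := ⟨(h t).riemVolume_univ_lt_top⟩
  have hK2 : Continuous fun p : M × M ↦ hflow.heatKernelFn hh hR t p.1 (p.2, s) :=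
    (hflow.continuousOn_heatKernelFn hh hR ht).comp_continuous
      (continuous_fst.prodMk (continuous_snd.prodMk continuous_const))
      fun p ↦ ⟨mem_univ _, mem_univ _, hs⟩
  obtain ⟨C, hC⟩ := isCompact_univ.exists_bound_of_continuousOn hK2.continuousOn
  refine continuous_of_dominated (F := fun y x ↦ hflow.heatKernelFn hh hR t x (y, s))
    (bound := fun _ ↦ C) (fun y ↦ ?_) (fun y ↦ Eventually.of_forall fun x ↦ ?_)
    (integrable_const C) (Eventually.of_forall fun x ↦ ?_)
  · have hc : Continuous fun x ↦ hflow.heatKernelFn hh hR t x (y, s) :=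
      hK2.comp (continuous_id.prodMk continuous_const : Continuous fun x : M ↦ (x, y))
    exact hc.aestronglyMeasurable
  · exact hC (x, y) (mem_univ _)
  · exact hK2.comp (continuous_const.prodMk continuous_id : Continuous fun y : M ↦ (x, y))

/-- **Bamler 2020a, (7.3): the forward-variable mass of the heat kernel of a Ricci flow is at most
`e^{−R_min (t − s)}`.** For a Ricci flow `(h, cov)` on `[a, T]` of a `C^∞` family of Riemannian
metrics on a closed connected manifold modelled on `ℝᵐ`, `a < s < t ≤ T`, `R ≥ R_min` on
`M × [s, t]` and every `y ∈ M`,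

  `∫_M K(x,t;y,s) dg_t(x) ≤ e^{−R_min (t − s)}`

("since `d/dt ∫_M u dg_t = −∫_M R u dg_t ≤ −R_min ∫_M u dg_t`", for `u = K(·,·;y,s)` a solution
of the heat equation in the forward variables). Proof avoiding the pole: for smooth `ζ ≥ 0`,
`∫ (∫ K(x,t;y,s) dV_t(x)) ζ(y) dV_s(y) = ∫ (P_{s→t}ζ) dV_t ≤ e^{−R_min (t−s)} ∫ ζ dV_s`
(`integral_heatValue_eq_integral_integral_heatKernelFn_mul`, `integral_heatValue_le_exp_neg_mul`),
and the fundamental lemma (`le_of_forall_integral_mul_contMDiff_le`) gives the pointwise bound for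
the continuous function `y ↦ ∫ K(x,t;y,s) dV_t(x)`. [cite: Bamler2020Entropy, §7.2, (7.3)] -/
theorem integral_heatKernelFn_basePoint_le_exp (hflow : IsRicciFlow h cov (Icc a T))
    (hh : IsContMDiffFamilyOn ∞ h univ) (hR : ∀ r, (h r).IsRiemannian) {s t : ℝ} (has : a < s)
    (hst : s < t) (htT : t ≤ T) {Rmin : ℝ}
    (hRmin : ∀ r ∈ Icc s t, ∀ z : M, Rmin ≤ (h r).scalarCurvatureWith (cov r) z) (y : M) :
    ∫ x, hflow.heatKernelFn hh hR t x (y, s) ∂(h t).riemVolume ≤ Real.exp (-Rmin * (t - s)) := by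
  have ht : t ∈ Ioc a T := ⟨has.trans hst, htT⟩
  have hs : s ∈ Ioo a t := ⟨has, hst⟩
  haveI : IsFiniteMeasure (h s).riemVolume := ⟨(h s).riemVolume_univ_lt_top⟩
  haveI : (h s).riemVolume.IsOpenPosMeasure := by
    rw [riemVolume_eq (hR s)]; exact isOpenPosMeasure_riemannianMeasure _
  refine le_of_forall_integral_mul_contMDiff_le (J := I) ((h s).riemVolume) isOpen_univ
    (hflow.continuous_integral_heatKernelFn_basePoint hh hR ht hs).continuousOn
    (fun ζ hζ _ _ hζ0 ↦ ?_) y (mem_univ y)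
  rw [← hflow.integral_heatValue_eq_integral_integral_heatKernelFn_mul hh hR ht hs hζ]
  exact hflow.integral_heatValue_le_exp_neg_mul hh hR has.le hst htT hRmin hζ hζ0

end ForwardMass

end Literature.Geometry.Riemannian

end
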